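import Literature.NumberTheory.EllipticCurves.TowerSaturatedCartesianProofs
import Literature.NumberTheory.EllipticCurves.ZpExtensionEisensteinSelmerStructureProofs
import Literature.NumberTheory.EllipticCurves.TowerCompatibleFamiliesKonigProofs
import HarnessLib

/-!
# Saturated level conditions are cartesian, II: Kőnig for red-stable constraints, and the PRESENTED
# form of the cartesian property (arbitrary quotient presentations of one level; theorems only)

`Proofs` file (theorems only; no definition, no named fact, no instance, no `sorry`), in the currency of the
tree's abstract towers `Literature.NumberTheory.EllipticCurves.Tower.*` (`compatibleFamilies`,
`saturatedFamilies`, `levelCondition`, `redIter`; files `ZpExtensionEisensteinSelmerStructure`,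
`TowerCompatibleFamiliesKonigProofs`, `TowerSaturatedCartesianProofs`).

Howard 2004, Hypothesis H.3 («`F` is cartesian on `Quot(T)` at every `v ∈ Σ(F)`», Def. 1.1.2–1.1.3; for
`F_𝔮` it «follows from Lemma 3.7.1 of [Mazur–Rubin] and the fact that `F_𝔮` on `T_𝔮` is obtained by
propagation from `V_𝔮`», arXiv:1202.6340 p. 16 L1–3) quantifies over ALL presentations `T_k/I`, `T_k/J` of
quotients of the level `T_k` by ideals of `R_k` and all injective `Quot`-morphisms `α` (tree:
`Howard2004.IsCartesianOnQuotAt`, shape `propagate L = (propagate L).comap H¹(α)`).  Part I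
(`TowerSaturatedCartesianProofs`, `Tower.comap_levelCondition_eq_of_liftable`) proves the property between two
LEVELS of the tower along `×p^d`.  This file adds:

* §1 **Kőnig for reduction-stable constraints** (towers of finite groups): if `S_j ⊆ H_j` are nonempty with
  `red_j S_{j+1} ⊆ S_j` then some compatible family meets every `S_j`
  (`Tower.exists_mem_compatibleFamilies_of_forall_mem`; Mathlib `nonempty_sections_of_finite_inverse_system`),
  and the «eventually» form with constraints only from a level `B` on
  (`…_of_forall_mem_of_le`) — the compactness step of the cohomological inputs (L) LIFTABILITY / (E) EXACTNESS
  of part I (memo `HOME/p1/H3-CARTESIAN-PLAN`, steps (L)/(E): lifts exist level by level by the long exact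
  sequences, a compatible choice by Kőnig).
* §2 small bookkeeping on compatible families (vanishing below a vanishing level; endomorphism systems).
* §3 **the PRESENTED cartesian property** `Tower.map_levelCondition_eq_comap_of_liftable`: for ONE level `B`, two
  arbitrary abelian groups `Q_I`, `Q_J` receiving additive maps `π_I, π_J` from `H_B` (the `H¹` of two quotient
  presentations `T_B ↠ T_B/I`, `T_B ↠ T_B/J`), an additive `α : Q_I → Q_J` (the `H¹` of an injective
  `Quot`-morphism, «induced by a scalar `s`»: `α ∘ π_I = π_J ∘ (s•)`), and reduction-compatible endomorphism
  systems `σ_s = (s•)`, `σ_I` (a generator of `I` acting) on the tower with `π_I ∘ σ_I = 0`, the hypotheses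
  (L) «`α y = π_J x_B` for a compatible `x` ⇒ `y = π_I z_B` for a compatible `z`», (E) «`π_J x_B = 0` for a
  compatible `x` ⇒ `x = σ_s σ_I h` for a compatible `h`», and the SATURATION TRANSFER «`p^c = τ ∘ σ_s` with `τ`
  preserving the cores» give `(L_B).map π_I = ((L_B).map π_J).comap α` — literally the shape of
  `IsCartesianOnQuotAt` for `L_B = Tower.levelCondition red p C B`, INCLUDING the `π`-adic quotients
  `T_B/π^i T_B` that are not levels of a `p`-adic tower (memo remark (2)).  Proof = D1's memo verbatim
  (lift, correct by (E), saturation).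

Cell `pub/bsd-print-x9`, shared μ-item of rows 9/10, skeleton v9 STUB 1b (H.3); seat `bsd-line-x10b-p1-w7` g0.
No summit statement is proved; BSD is not proved by any of this.

References: B. Howard, Compositio Math. 140 (2004), Def. 1.1.1–1.1.3, H.3, §1.6 (arXiv:1202.6340 p. 5
L28–44 and L88–99, p. 7 L65–67, p. 12 L29–55, p. 16 L1–3); B. Mazur, K. Rubin, *Kolyvagin systems* (2004),
Lemma 3.7.1; J.-P. Serre, *Galois Cohomology* (1997), I §2.2; J. Neukirch, A. Schmidt, K. Wingberg (2008),
Cor. 2.7.6 (Mittag-Leffler for finite systems).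
-/

noncomputable section

open CategoryTheory

universe u v w

namespace Literature.NumberTheory.EllipticCurves

namespace Tower

variable {H : ℕ → Type u} [∀ j, AddCommGroup (H j)] (red : ∀ j, H (j + 1) →+ H j)

/-! ## §1 Kőnig's lemma for reduction-stable constraints -/

/-- **Kőnig's lemma, constraint form.** In a tower of FINITE abelian groups, if `S_j ⊆ H_j` are nonempty sets
with `red_j (S_{j+1}) ⊆ S_j`, then there is a compatible family `x ∈ lim_j H_j` with `x_j ∈ S_j` for every `j`
(a section of the inverse system of finite nonempty sets `S_j`; Mathlib `nonempty_sections_of_finite_inverse_system`).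
[cite: SerreGaloisCohomology1997, Ch. I §2.2 (limits of finite modules; compactness)]
[cite: NeukirchSchmidtWingberg2008, Cor. 2.7.6 (Mittag-Leffler)] -/
theorem exists_mem_compatibleFamilies_of_forall_mem [∀ j, Finite (H j)] (S : ∀ j, Set (H j))
    (hne : ∀ j, (S j).Nonempty) (hst : ∀ j, ∀ w ∈ S (j + 1), red j w ∈ S j) :
    ∃ x ∈ compatibleFamilies red, ∀ j, x j ∈ S j := by
  classical
  let C : ℕ → Type u := fun j ↦ S j
  haveI hCne : ∀ j, Nonempty (C j) := fun j ↦ (hne j).to_subtype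
  haveI : ∀ j, Finite (C j) := fun j ↦ Subtype.finite
  let f : ∀ j, C (j + 1) → C j := fun j w ↦ ⟨red j w.1, hst j w.1 w.2⟩
  let F : ℕᵒᵖ ⥤ Type u := Functor.ofOpSequence (X := C) (fun j ↦ TypeCat.ofHom (f j))
  haveI : ∀ j : ℕᵒᵖ, Finite (F.obj j) := fun j ↦ by
    change Finite (C j.unop); infer_instance
  haveI : ∀ j : ℕᵒᵖ, Nonempty (F.obj j) := fun j ↦ by
    change Nonempty (C j.unop); infer_instance
  obtain ⟨s, hs⟩ := nonempty_sections_of_finite_inverse_system F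
  refine ⟨fun j ↦ (s (Opposite.op j) : C j).1, ?_, fun j ↦ (s (Opposite.op j) : C j).2⟩
  rw [mem_compatibleFamilies_iff]
  intro j
  have hsj := hs (homOfLE (Nat.le_add_right j 1)).op
  rw [Functor.ofOpSequence_map_homOfLE_succ] at hsj
  exact congrArg Subtype.val hsj

/-- **Kőnig's lemma, eventual constraint form.** Constraints imposed only from a level `B` on: if for every
`j ≥ B` the set `S_j ⊆ H_j` is nonempty and `red_j (S_{j+1}) ⊆ S_j`, then some compatible family has `x_j ∈ S_j`
for all `j ≥ B` (apply the constraint form to `{w | B ≤ j → w ∈ S_j}`).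
[cite: SerreGaloisCohomology1997, Ch. I §2.2] [cite: NeukirchSchmidtWingberg2008, Cor. 2.7.6] -/
theorem exists_mem_compatibleFamilies_of_forall_mem_of_le [∀ j, Finite (H j)] (B : ℕ) (S : ∀ j, Set (H j))
    (hne : ∀ j, B ≤ j → (S j).Nonempty) (hst : ∀ j, B ≤ j → ∀ w ∈ S (j + 1), red j w ∈ S j) :
    ∃ x ∈ compatibleFamilies red, ∀ j, B ≤ j → x j ∈ S j := by
  obtain ⟨x, hx, hxS⟩ := exists_mem_compatibleFamilies_of_forall_mem red (fun j ↦ {w | B ≤ j → w ∈ S j})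
    (fun j ↦ by
      by_cases hj : B ≤ j
      · obtain ⟨w, hw⟩ := hne j hj
        exact ⟨w, fun _ ↦ hw⟩
      · exact ⟨0, fun h ↦ absurd h hj⟩)
    (fun j w hw hj ↦ hst j hj w (hw (hj.trans (Nat.le_succ j))))
  exact ⟨x, hx, fun j hj ↦ hxS j hj⟩

/-! ## §2 Bookkeeping on compatible families -/

/-- A compatible family vanishing at level `n` vanishes at every level `j ≤ n`.
[cite: SerreGaloisCohomology1997, Ch. I §2.2 (inverse limits)] -/
theorem apply_eq_zero_of_apply_eq_zero_of_le {x : Π j, H j} (hx : x ∈ compatibleFamilies red) {n : ℕ}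
    (hn : x n = 0) {j : ℕ} (hj : j ≤ n) : x j = 0 := by
  obtain ⟨e, rfl⟩ := Nat.exists_eq_add_of_le hj
  rw [← redIter_apply_of_mem_compatibleFamilies red hx j e, hn, map_zero]

/-- A reduction-compatible system of additive endomorphisms `e_j : H_j → H_j` acts on compatible families.
[cite: Howard2004HeegnerKolyvagin, §1.6 and §2.2 (T_𝔮 is an S_𝔮[G_K]-module; arXiv p. 12)] -/
theorem map_mem_compatibleFamilies (e : ∀ j, H j →+ H j)
    (hred : ∀ j (y : H (j + 1)), red j (e (j + 1) y) = e j (red j y)) {x : Π j, H j}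
    (hx : x ∈ compatibleFamilies red) : (fun j ↦ e j (x j)) ∈ compatibleFamilies red := by
  rw [mem_compatibleFamilies_iff] at hx ⊢
  intro j
  rw [hred, hx]

/-! ## §3 The presented cartesian property -/

section Presented

variable {QI : Type v} {QJ : Type w} [AddCommGroup QI] [AddCommGroup QJ]

/-- **The easy inclusion of the presented cartesian property**: with `α ∘ π_I = π_J ∘ σ_s` on level `B` for a
reduction-compatible, core-preserving endomorphism system `σ_s` («multiplication by the scalar `s`»), the
propagated condition `π_I (L_B)` is mapped by `α` into `π_J (L_B)`: `α (π_I x_B) = π_J ((σ_s x)_B)` and `σ_s x` is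
saturated with `x`. [cite: Howard2004HeegnerKolyvagin, Def. 1.1.2–1.1.3 and H.3 (arXiv p. 5 L88–99, p. 7 L65–67)] -/
theorem map_levelCondition_le_comap (p : ℕ) (C : ∀ j, AddSubgroup (H j)) (B : ℕ)
    (πI : H B →+ QI) (πJ : H B →+ QJ) (α : QI →+ QJ) (σs : ∀ j, H j →+ H j)
    (hσs : ∀ j (y : H (j + 1)), red j (σs (j + 1) y) = σs j (red j y))
    (hCs : ∀ j, ∀ y ∈ C j, σs j y ∈ C j)
    (hα : ∀ y : H B, α (πI y) = πJ (σs B y)) :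
    (levelCondition red p C B).map πI ≤ ((levelCondition red p C B).map πJ).comap α := by
  rintro _ ⟨y, hy, rfl⟩
  rw [AddSubgroup.mem_comap, hα]
  exact AddSubgroup.mem_map_of_mem πJ (map_mem_levelCondition red p C σs hσs (fun j y h ↦ hCs j y h) hy)

/-- **Saturated level conditions are cartesian — PRESENTED form** (the abstract core of Howard's H.3 for a
Selmer structure propagated from `V`, for ARBITRARY presentations of two quotients of the level `T_B` and an
injective `Quot`-morphism between them).  Data: the tower `(H_j, red_j)` (`H_j = H¹(K_v, T/p^j T)`), cores
`C_j`, the base level `B`; abelian groups `Q_I`, `Q_J` (`H¹(K_v, T_B/I)`, `H¹(K_v, T_B/J)`) with `π_I`, `π_J`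
from `H_B` (the `H¹` of the presentations) and `α : Q_I → Q_J` (the `H¹` of the injective morphism «induced by
the scalar `s`»); reduction-compatible endomorphism systems `σ_s` (`= s•`, core-preserving) and `σ_I` (a generator
of `I` acting; `π_I ∘ σ_I = 0` on `H_B`) with `α ∘ π_I = π_J ∘ σ_s`; SATURATION TRANSFER `p^c = τ_j ∘ σ_s` for a
core-preserving system `τ` (for `s = π^d`, `𝔪 = (π)`, `π^m ∼ p`: `τ = ±π^{mc-d}`).  Hypotheses (cohomological,
supplied by the instantiator): (L) LIFTABILITY «`α y = π_J x_B`, `x` compatible ⇒ `y = π_I z_B`, `z` compatible»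
and (E) EXACTNESS «`π_J x_B = 0`, `x` compatible ⇒ `x = σ_s σ_I h`, `h` compatible» (`ker (H¹(T) → H¹(T_B/J)) =
J·H¹(T)` with `J = s·I`).  Conclusion: `π_I (L_B) = α⁻¹ (π_J (L_B))`.  Proof (D1's memo verbatim): `α y = π_J x_B`
with `x` saturated; lift `y = π_I z_B` (L); `π_J ((σ_s z - x)_B) = α y - α y = 0`, so `σ_s z - x = σ_s σ_I h` (E);
`z' := z - σ_I h` has `π_I z'_B = y` and `σ_s z' = x`, whence `p^{a+c} z'_j = τ_j (p^a x_j) ∈ C_j`: `z'` is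
saturated and `y ∈ π_I (L_B)`.
[cite: Howard2004HeegnerKolyvagin, H.3 and Prop. 2.1.3 proof (arXiv p. 7 L65–67, p. 16 L1–3)]
[cite: MazurRubinMemoirs2004, Lemma 3.7.1] -/
theorem map_levelCondition_eq_comap_of_liftable (p : ℕ) (C : ∀ j, AddSubgroup (H j)) (B : ℕ)
    (πI : H B →+ QI) (πJ : H B →+ QJ) (α : QI →+ QJ) (σs σI : ∀ j, H j →+ H j)
    (hσs : ∀ j (y : H (j + 1)), red j (σs (j + 1) y) = σs j (red j y))
    (hσI : ∀ j (y : H (j + 1)), red j (σI (j + 1) y) = σI j (red j y))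
    (hCs : ∀ j, ∀ y ∈ C j, σs j y ∈ C j)
    (hα : ∀ y : H B, α (πI y) = πJ (σs B y))
    (hπI : ∀ y : H B, πI (σI B y) = 0)
    (hsat : ∃ (c : ℕ) (τ : ∀ j, H j →+ H j), (∀ j, ∀ y ∈ C j, τ j y ∈ C j) ∧
      ∀ j (y : H j), p ^ c • y = τ j (σs j y))
    (hL : ∀ y : QI, (∃ x ∈ compatibleFamilies red, α y = πJ (x B)) →
      ∃ z ∈ compatibleFamilies red, πI (z B) = y)
    (hE : ∀ x ∈ compatibleFamilies red, πJ (x B) = 0 →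
      ∃ h ∈ compatibleFamilies red, ∀ j, σs j (σI j (h j)) = x j) :
    (levelCondition red p C B).map πI = ((levelCondition red p C B).map πJ).comap α := by
  refine le_antisymm (map_levelCondition_le_comap red p C B πI πJ α σs hσs hCs hα) ?_
  intro y hy
  rw [AddSubgroup.mem_comap] at hy
  obtain ⟨_, hxL, hxy⟩ := hy
  obtain ⟨x, hx, rfl⟩ := (mem_levelCondition_iff red p C B _).mp hxL
  have hxc : x ∈ compatibleFamilies red := saturatedFamilies_le_compatibleFamilies red p C hx
  -- (L): lift `y` to a compatible family `z`
  obtain ⟨z, hz, hzy⟩ := hL y ⟨x, hxc, hxy.symm⟩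
  -- `σ_s z - x` vanishes under `π_J` at level `B`
  have hsz : (fun j ↦ σs j (z j)) ∈ compatibleFamilies red := map_mem_compatibleFamilies red σs hσs hz
  have hvan : πJ (((fun j ↦ σs j (z j)) - x) B) = 0 := by
    rw [Pi.sub_apply, map_sub, ← hα, hzy, hxy, sub_self]
  -- (E): `σ_s z - x = σ_s σ_I h`
  obtain ⟨h, hh, hzx⟩ := hE _ (sub_mem hsz hxc) hvan
  -- `z' := z - σ_I h` is saturated with `π_I z'_B = y` and `σ_s z' = x`
  have hIh : (fun j ↦ σI j (h j)) ∈ compatibleFamilies red := map_mem_compatibleFamilies red σI hσI hh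
  obtain ⟨a, ha⟩ := ((mem_saturatedFamilies_iff red p C x).mp hx).2
  obtain ⟨c, τ, hτC, hτ⟩ := hsat
  have hz'x : ∀ j, σs j ((z - fun j ↦ σI j (h j)) j) = x j := fun j ↦ by
    have hj := hzx j
    rw [Pi.sub_apply] at hj
    rw [Pi.sub_apply, map_sub, hj, sub_sub_cancel]
  have hz' : (z - fun j ↦ σI j (h j)) ∈ saturatedFamilies red p C := by
    refine (mem_saturatedFamilies_iff red p C _).mpr ⟨?_, a + c, fun j ↦ ?_⟩
    · exact (mem_compatibleFamilies_iff red _).mp (sub_mem hz hIh)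
    · rw [pow_add, mul_smul, hτ, hz'x j, ← map_nsmul]
      exact hτC j _ (ha j)
  have hz'y : πI ((z - fun j ↦ σI j (h j)) B) = y := by
    rw [Pi.sub_apply, map_sub, hπI, sub_zero, hzy]
  rw [← hz'y]
  exact AddSubgroup.mem_map_of_mem πI (apply_mem_levelCondition red p C hz' B)

end Presented

end Tower

end Literature.NumberTheory.EllipticCurves

end
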